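import Mathlib
import Summits.NavierStokesRegularity.FluidComputer.TransportSobolevEnergyZero
import Summits.NavierStokesRegularity.FluidComputer.TransportGalerkinEnergyLevel
import Summits.NavierStokesRegularity.FluidComputer.TransportGalerkinBilinearLoss
import Summits.NavierStokesRegularity.FluidComputer.TransportGalerkinOneSided
import Summits.NavierStokesRegularity.FluidComputer.TransportGalerkinResidencePrep
import HarnessLib

/-!
# Galerkin limit of the transport model, XXI: UNIQUENESS AMONG ALL SPATIALLY SMOOTH CLASSICAL SOLUTIONS — the `L²` energy of the difference (instab g20, cell `ns-blowup`, 2026-08-27)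

HONEST FRAMING (human ruling D-0035): nothing here is a claim about Navier–Stokes blow-up.
WHAT THIS IS NOT: not NS — a MODEL theorem schema (perturbation equation about a smooth host on
`𝕋^d` in the scaled phase space `E = lp (ℤ^d → V) 2`). No number or census word moves.

PURPOSE. `TransportGalerkinExistence.eqOn_of_solutions` (g20, part XVII) gives uniqueness of THE
solution inside the class «UNIFORM polynomial tail of scaled order `d + 3`» (what the Wilczak–Zgliczyński
box needs). This file widens the class to what the PDE asks: every classical solution `w₂ : [0, T] → E`
(continuous, `w₂' = F(w₂)` on `(0, T)`) whose values on `(0, T)` are SPATIALLY SMOOTH (rapidly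
decreasing) and keep the three linear clauses — NO uniformity in `t` — coincides on `[0, T]` with a
reference solution `w₁` of the same kind whose unscaled first moment `A₁(Λ⁻² ⇑(w₁ t)) = ∑⟨l⟩‖·‖` is
bounded on `(0, T)` (`eqOn_of_smooth_solutions`); THE solution of part XVII qualifies as `w₁`
(`TransportGalerkinSmooth.smooth_of_tendstoUniformlyOn`). Mechanism — the classical weak–strong `L²`
argument on the lattice: with `η = û₁ − û₂`, `F(û₁) − F(û₂) = νΔη + B(Uv, η) + B(η, Uv) + B(η, û₁) + B(û₂, η)`
(`linCoeff_sub`, `bilCoeff_sub_split`); against `η` the Leray symbol drops, dissipation is non-positive,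
the TRANSPORT pairings `B(Uv, η)`, `B(û₂, η)` are purely imaginary (`re_pairing_transport_eq_zero` —
so `û₂` needs no bound), the STRETCHING pairings are `≤ (card d·2π)·A₁(·)·‖η‖₀²`
(`abs_re_pairing_wmul_stretching_le` at order zero): `two_re_pairing_field_sub_le`. Along two solutions
this is `e' ≤ K e` for `e(t) = ‖Λ⁻²(w₁ t − w₂ t)‖₀² = Re⟪D₄ ·, ·⟫` (`D₄ = diag ⟨k⟩⁻⁴`), differentiable on
`(0, T)` only — Gronwall on `[s, t]`, `s → 0⁺`. The junk value of `nsField` (`ofCoeff`, `0` off `ℓ²`)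
does not bite: on rapidly decreasing elements the field takes its defining value
(`coe_linOp_of_rapidDecay` / `coe_bilOp_of_rapidDecay`). General finite `d`, Hilbert `V`; Mathlib + the
tree files cited; no new definitions.
-/

noncomputable section

open scoped ENNReal NNReal ComplexConjugate InnerProductSpace
open Set Filter Topology

namespace Summit.NavierStokesRegularity.FluidComputer.TransportGalerkinUnique

open Complex
open Literature.Analysis.FunctionSpaces Literature.Analysis.FunctionSpaces.Lattice
open Literature.Analysis.FunctionSpaces.Torus
open Summit.NavierStokesRegularity.FluidComputer.GalerkinLatticePhaseSpace
open Summit.NavierStokesRegularity.FluidComputer.TransportCommutatorLattice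
open Summit.NavierStokesRegularity.FluidComputer.TransportSkewLattice
open Summit.NavierStokesRegularity.FluidComputer.TransportSobolevEnergy
open Summit.NavierStokesRegularity.FluidComputer.TransportSobolevSelfAdvection
open Summit.NavierStokesRegularity.FluidComputer.TransportSobolevEnergyZero
open Summit.NavierStokesRegularity.FluidComputer.TransportGalerkin
open Summit.NavierStokesRegularity.FluidComputer.TransportGalerkinRapid
open Summit.NavierStokesRegularity.FluidComputer.TransportGalerkinBox
open Summit.NavierStokesRegularity.FluidComputer.TransportGalerkinWeights
open Summit.NavierStokesRegularity.FluidComputer.TransportGalerkinEnergyLevel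
open Summit.NavierStokesRegularity.FluidComputer.TransportGalerkinBilinearLoss
open Summit.NavierStokesRegularity.FluidComputer.TransportGalerkinOneSided
open Summit.NavierStokesRegularity.FluidComputer.TransportGalerkinResidencePrep

variable {d : Type*} [Fintype d]
variable {V : Type*} [NormedAddCommGroup V] [InnerProductSpace ℂ V] [CompleteSpace V]

section Pairings

/-- **Transport is skew at order zero**: for a rapidly decreasing advecting family `a`, real and
divergence-free through `π`, and a rapidly decreasing `η`, `Re ⟨B(a, η), η⟩ = 0`. -/
theorem re_pairing_bilCoeff_transport_eq_zero (π : d → (V →L[ℂ] ℂ)) {a η : (d → ℤ) → V}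
    (ha : RapidDecay a) (hη : RapidDecay η)
    (hreal : ∀ j p, π j (a (-p)) = conj (π j (a p)))
    (hdiv : ∑ j, freqDeriv j (fun p => π j (a p)) = 0) :
    (pairing (bilCoeff π a η) η).re = 0 := by
  rw [bilCoeff_eq, pairing_neg_left, Complex.neg_re,
    re_pairing_transport_eq_zero (fun j p => π j (a p)) (fun j => ha.comp_apply (π j)) hreal hdiv
      (eNormSq_lt_top_of_rapidDecay hη 1), neg_zero]

omit [CompleteSpace V] in
/-- **Stretching is bounded at order zero by the first moment of the target**: for rapidly
decreasing `η`, `b` and `‖π_j‖ ≤ 1`, `|Re ⟨B(η, b), η⟩| ≤ (card d·2π)·A₁(b)·‖η‖₀²`,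
`A₁(b) = ∑⟨l⟩‖b l‖`. -/
theorem abs_re_pairing_bilCoeff_stretching_le (π : d → (V →L[ℂ] ℂ)) (hπ : ∀ j, ‖π j‖ ≤ 1)
    {η b : (d → ℤ) → V} (hη : RapidDecay η) (hb : RapidDecay b) :
    |(pairing (bilCoeff π η b) η).re| ≤ ((Fintype.card d : ℝ) * (2 * Real.pi)) *
      (∑' l, ENNReal.ofReal (sobolevWeight 1 l) * ‖b l‖ₑ).toReal * (eNormSq 0 η).toReal := by
  have h := abs_re_pairing_wmul_stretching_le (le_refl (0 : ℝ)) π hπ b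
    (by rw [zero_add]; exact tsum_weight_mul_enorm_lt_top hb 1) (eNormSq_lt_top_of_rapidDecay hη 0)
  rw [wmul_zero, wmul_zero, zero_add, zero_div, Real.rpow_zero, one_mul] at h
  rw [bilCoeff_eq, pairing_neg_left, Complex.neg_re, abs_neg]
  exact h

omit [CompleteSpace V] in
/-- **Dissipation is non-positive at order zero**: `Re ⟨∑_j ∂_j∂_j η, η⟩ ≤ 0`. -/
theorem re_pairing_laplacian_nonpos {η : (d → ℤ) → V} (hη : RapidDecay η) :
    (pairing (∑ j, freqDeriv j (freqDeriv j η)) η).re ≤ 0 := by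
  have hη1 : eNormSq 1 η < ∞ := eNormSq_lt_top_of_rapidDecay hη _
  have h := re_pairing_wmul_laplacian_eq (0 : ℝ) (u := η) (by rw [zero_add]; exact hη1)
  rw [wmul_zero, wmul_zero, zero_add] at h
  rw [h]
  have hmono : (eNormSq 0 η).toReal ≤ (eNormSq 1 η).toReal :=
    ENNReal.toReal_mono hη1.ne (eNormSq_mono zero_le_one η)
  nlinarith [hmono, sq_nonneg (2 * Real.pi)]

omit [CompleteSpace V] in
/-- `linCoeff` through the bilinearity: `νΔu − (U·∇)u − (u·∇)U = ν ∑∂∂u + B(Uv, u) + B(u, Uv)`. -/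
theorem linCoeff_eq_laplacian_add_bilCoeff (ν : ℝ) (Uv : (d → ℤ) → V) (π : d → (V →L[ℂ] ℂ))
    (u : (d → ℤ) → V) :
    linCoeff ν Uv π u = (ν : ℂ) • (∑ j, freqDeriv j (freqDeriv j u)) + bilCoeff π Uv u + bilCoeff π u Uv := by
  rw [linCoeff_eq, bilCoeff_eq, bilCoeff_eq]
  abel

end Pairings

section Estimate

/-- **`2 Re ⟨P(F(û₁)) − P(F(û₂)), û₁ − û₂⟩₀ ≤ 2 (card d·2π)(A₁(Uv) + A₁(û₁)) ‖û₁ − û₂‖₀²`**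
(`two_re_pairing_field_sub_le`; `F(u) = linCoeff ν Uv π u + bilCoeff π u u`, `ν ≥ 0`). Host `Uv` and
both families rapidly decreasing, `P`-fixed, real and divergence-free through `π` (`‖π_j‖ ≤ 1`, `P`
modewise self-adjoint). Only the REFERENCE family `û₁` enters the constant. -/
theorem two_re_pairing_field_sub_le {ν : ℝ} (hν : 0 ≤ ν) {Uv : (d → ℤ) → V} (hUv : RapidDecay Uv)
    (π : d → (V →L[ℂ] ℂ)) (hπ : ∀ j, ‖π j‖ ≤ 1)
    (hUreal : ∀ j p, π j (Uv (-p)) = conj (π j (Uv p)))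
    (hUdiv : ∑ j, freqDeriv j (fun p => π j (Uv p)) = 0)
    (P : (d → ℤ) → (V →L[ℂ] V)) (hPsa : ∀ k, IsSelfAdjoint (P k))
    {u₁ u₂ : (d → ℤ) → V} (hu₁ : RapidDecay u₁) (hu₂ : RapidDecay u₂)
    (hfix₁ : ∀ k, P k (u₁ k) = u₁ k) (hfix₂ : ∀ k, P k (u₂ k) = u₂ k)
    (hreal₂ : ∀ j p, π j (u₂ (-p)) = conj (π j (u₂ p)))
    (hdiv₂ : ∑ j, freqDeriv j (fun p => π j (u₂ p)) = 0) :
    2 * (pairing ((fun k => P k (linCoeff ν Uv π u₁ k + bilCoeff π u₁ u₁ k)) -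
        fun k => P k (linCoeff ν Uv π u₂ k + bilCoeff π u₂ u₂ k)) (u₁ - u₂)).re ≤
      2 * (((Fintype.card d : ℝ) * (2 * Real.pi)) *
        ((∑' l, ENNReal.ofReal (sobolevWeight 1 l) * ‖Uv l‖ₑ).toReal +
          (∑' l, ENNReal.ofReal (sobolevWeight 1 l) * ‖u₁ l‖ₑ).toReal)) * (eNormSq 0 (u₁ - u₂)).toReal := by
  set η : (d → ℤ) → V := u₁ - u₂ with hη
  have hηr : RapidDecay η := hu₁.sub' hu₂
  have hfixη : ∀ k, P k (η k) = η k := fun k => by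
    simp only [hη, Pi.sub_apply, map_sub, hfix₁ k, hfix₂ k]
  -- the field difference: `ν L + B(Uv, η) + B(η, Uv) + B(η, u₁) + B(u₂, η)`
  set L := ∑ j, freqDeriv j (freqDeriv j η) with hL
  have hG : ((fun k => P k (linCoeff ν Uv π u₁ k + bilCoeff π u₁ u₁ k)) -
      fun k => P k (linCoeff ν Uv π u₂ k + bilCoeff π u₂ u₂ k)) =
      fun k => P k (((ν : ℂ) • L + bilCoeff π Uv η + bilCoeff π η Uv + bilCoeff π η u₁ + bilCoeff π u₂ η) k) := by
    have h1 := linCoeff_sub (ν := ν) hUv π hu₁ hu₂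
    have h2 := bilCoeff_sub_split π hu₁ hu₂
    have h3 := linCoeff_eq_laplacian_add_bilCoeff ν Uv π η
    funext k
    have h1k := congrFun h1 k
    have h2k := congrFun h2 k
    have h3k := congrFun h3 k
    simp only [Pi.sub_apply, Pi.add_apply, Pi.smul_apply] at h1k h2k h3k ⊢
    rw [← map_sub]
    congr 1
    rw [← hη] at h1k h2k
    have : linCoeff ν Uv π u₁ k + bilCoeff π u₁ u₁ k - (linCoeff ν Uv π u₂ k + bilCoeff π u₂ u₂ k) =
        (linCoeff ν Uv π u₁ k - linCoeff ν Uv π u₂ k) + (bilCoeff π u₁ u₁ k - bilCoeff π u₂ u₂ k) := by abel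
    rw [this, ← h1k, h2k, h3k, hL]
    abel
  -- rapid decay of the five pieces
  have hLr : RapidDecay L := RapidDecay.finset_sum _ fun j _ => (hηr.freqDeriv' j).freqDeriv' j
  have hB₁ : RapidDecay (bilCoeff π Uv η) := rapidDecay_bilCoeff π hUv hηr
  have hB₂ : RapidDecay (bilCoeff π η Uv) := rapidDecay_bilCoeff π hηr hUv
  have hB₃ : RapidDecay (bilCoeff π η u₁) := rapidDecay_bilCoeff π hηr hu₁
  have hB₄ : RapidDecay (bilCoeff π u₂ η) := rapidDecay_bilCoeff π hu₂ hηr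
  -- drop the Leray symbol and split the pairing
  rw [hG, pairing_apply_eq_of_isSelfAdjoint P hPsa _ _ hfixη]
  have hsL : Summable fun k => ⟪((ν : ℂ) • L) k, η k⟫_ℂ := by
    refine ((summable_inner_rapid hLr hηr).const_smul (conj (ν : ℂ))).congr fun k => ?_
    rw [Pi.smul_apply, inner_smul_left, smul_eq_mul]
  have hs₁ := summable_inner_rapid hB₁ hηr
  have hs₂ := summable_inner_rapid hB₂ hηr
  have hs₃ := summable_inner_rapid hB₃ hηr
  have hs₄ := summable_inner_rapid hB₄ hηr
  have hsum1 : Summable fun k => ⟪((ν : ℂ) • L + bilCoeff π Uv η) k, η k⟫_ℂ := by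
    refine (hsL.add hs₁).congr fun k => ?_; simp only [Pi.add_apply, inner_add_left]
  have hsum2 : Summable fun k => ⟪((ν : ℂ) • L + bilCoeff π Uv η + bilCoeff π η Uv) k, η k⟫_ℂ := by
    refine (hsum1.add hs₂).congr fun k => ?_; simp only [Pi.add_apply, inner_add_left]
  have hsum3 : Summable fun k => ⟪((ν : ℂ) • L + bilCoeff π Uv η + bilCoeff π η Uv + bilCoeff π η u₁) k, η k⟫_ℂ := by
    refine (hsum2.add hs₃).congr fun k => ?_; simp only [Pi.add_apply, inner_add_left]
  rw [pairing_add_left hsum3 hs₄, pairing_add_left hsum2 hs₃, pairing_add_left hsum1 hs₂,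
    pairing_add_left hsL hs₁, pairing_smul_left, Complex.conj_ofReal]
  -- the five estimates
  have hdiss : (pairing L η).re ≤ 0 := re_pairing_laplacian_nonpos hηr
  have ht₁ : (pairing (bilCoeff π Uv η) η).re = 0 :=
    re_pairing_bilCoeff_transport_eq_zero π hUv hηr hUreal hUdiv
  have ht₂ := abs_re_pairing_bilCoeff_stretching_le π hπ hηr hUv
  have ht₃ := abs_re_pairing_bilCoeff_stretching_le π hπ hηr hu₁
  have ht₄ : (pairing (bilCoeff π u₂ η) η).re = 0 :=
    re_pairing_bilCoeff_transport_eq_zero π hu₂ hηr hreal₂ hdiv₂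
  simp only [Complex.add_re, Complex.mul_re, Complex.ofReal_re, Complex.ofReal_im, zero_mul, sub_zero,
    ht₁, ht₄, add_zero]
  have e₂ := (abs_le.1 ht₂).2
  have e₃ := (abs_le.1 ht₃).2
  have hνD : ν * (pairing L η).re ≤ 0 := mul_nonpos_of_nonneg_of_nonpos hν hdiss
  nlinarith [e₂, e₃, hνD]

end Estimate

section Weight

omit [Fintype d] in
/-- The symbol `⟨k⟩⁻⁴` is bounded by `1`. -/
theorem abs_sobolevWeight_neg_two_sq_le [Fintype d] (k : d → ℤ) : |sobolevWeight (-2) k ^ 2| ≤ 1 := by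
  rw [abs_of_nonneg (sq_nonneg _)]
  have h := sobolevWeight_le_one (by norm_num : (-2 : ℝ) ≤ 0) k
  have h0 := (sobolevWeight_pos (-2) k).le
  nlinarith

omit [CompleteSpace V] in
/-- **The `L²` weight `D₄ = diag ⟨k⟩⁻⁴` on `E` pairs like the unscaled families**:
`⟪D₄ x, y⟫ = ⟨Λ⁻² ⇑x, Λ⁻² ⇑y⟩`. -/
theorem inner_diag_four_eq_pairing {D : lp (fun _ : (d → ℤ) => V) 2 →L[ℝ] lp (fun _ : (d → ℤ) => V) 2}
    (hD : ∀ z, ⇑(D z) = fun k => ((sobolevWeight (-2) k ^ 2 : ℝ) : ℂ) • z k)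
    (x y : lp (fun _ : (d → ℤ) => V) 2) :
    ⟪D x, y⟫_ℂ = pairing (wmul (-2) (⇑x)) (wmul (-2) (⇑y)) := by
  rw [inner_diag_eq_tsum hD]
  unfold pairing
  refine tsum_congr fun k => ?_
  rw [wmul_apply, wmul_apply, inner_smul_left, inner_smul_right, Complex.conj_ofReal, ← mul_assoc,
    ← Complex.ofReal_mul, ← sq]

omit [CompleteSpace V] in
/-- **`Re⟪D₄ x, x⟫ = ‖Λ⁻² ⇑x‖₀²`** (the unscaled `L²` energy). -/
theorem re_inner_diag_four_self {D : lp (fun _ : (d → ℤ) => V) 2 →L[ℝ] lp (fun _ : (d → ℤ) => V) 2}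
    (hD : ∀ z, ⇑(D z) = fun k => ((sobolevWeight (-2) k ^ 2 : ℝ) : ℂ) • z k)
    (x : lp (fun _ : (d → ℤ) => V) 2) :
    RCLike.re ⟪D x, x⟫_ℂ = (eNormSq 0 (wmul (-2) (⇑x))).toReal := by
  have hfin : eNormSq 0 (wmul (-2) (⇑x)) < ∞ := by
    rw [eNormSq_wmul]
    exact (eNormSq_mono (by norm_num) _).trans_lt (eNormSq_zero_coe_lt_top x)
  rw [toReal_eNormSq_zero_eq_re_pairing hfin, ← inner_diag_four_eq_pairing hD, RCLike.re_to_complex]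

end Weight

section Unique

/-- **UNIQUENESS AMONG ALL SPATIALLY SMOOTH CLASSICAL SOLUTIONS** (`eqOn_of_smooth_solutions`).
Host: `ν ≥ 0`, `Uv` rapidly decreasing, real and divergence-free through `π` (`‖π_j‖ ≤ 1`), `P`
modewise self-adjoint contractions. Two classical solutions `w₁, w₂ : ℝ → E` of `w' = F(w)` on
`(0, T)`, continuous on `[0, T]`, `w₁ 0 = w₂ 0`, whose values on `(0, T)` are rapidly decreasing and
keep the three clauses (`P`-fixed, real, divergence-free through `π`), the REFERENCE solution `w₁`
having a bounded unscaled first moment `A₁(Λ⁻² ⇑(w₁ t)) ≤ A` on `(0, T)`. Then `w₁ = w₂` on `[0, T]`.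
No tail uniformity is asked of `w₂`. -/
theorem eqOn_of_smooth_solutions {ν : ℝ} (hν : 0 ≤ ν) {Uv : (d → ℤ) → V} (hUv : RapidDecay Uv)
    {π : d → (V →L[ℂ] ℂ)} (hπ : ∀ j, ‖π j‖ ≤ 1)
    (hUreal : ∀ j p, π j (Uv (-p)) = conj (π j (Uv p)))
    (hUdiv : ∑ j, freqDeriv j (fun p => π j (Uv p)) = 0)
    {P : (d → ℤ) → (V →L[ℂ] V)} (hPsa : ∀ k, IsSelfAdjoint (P k)) (hPn : ∀ k, ‖P k‖ ≤ 1)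
    {T : ℝ} {w₁ w₂ : ℝ → lp (fun _ : (d → ℤ) => V) 2}
    (hw₁c : ContinuousOn w₁ (Icc 0 T)) (hw₂c : ContinuousOn w₂ (Icc 0 T)) (h0 : w₁ 0 = w₂ 0)
    (hw₁' : ∀ t ∈ Ioo 0 T, HasDerivAt w₁ (nsField ν Uv π P (w₁ t)) t)
    (hw₂' : ∀ t ∈ Ioo 0 T, HasDerivAt w₂ (nsField ν Uv π P (w₂ t)) t)
    (hr₁ : ∀ t ∈ Ioo 0 T, RapidDecay (⇑(w₁ t))) (hr₂ : ∀ t ∈ Ioo 0 T, RapidDecay (⇑(w₂ t)))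
    (hfix₁ : ∀ t ∈ Ioo 0 T, ∀ k, P k ((w₁ t : (d → ℤ) → V) k) = (w₁ t : (d → ℤ) → V) k)
    (hfix₂ : ∀ t ∈ Ioo 0 T, ∀ k, P k ((w₂ t : (d → ℤ) → V) k) = (w₂ t : (d → ℤ) → V) k)
    (hreal₁ : ∀ t ∈ Ioo 0 T, ∀ j k, π j ((w₁ t : (d → ℤ) → V) (-k)) = conj (π j ((w₁ t : (d → ℤ) → V) k)))
    (hreal₂ : ∀ t ∈ Ioo 0 T, ∀ j k, π j ((w₂ t : (d → ℤ) → V) (-k)) = conj (π j ((w₂ t : (d → ℤ) → V) k)))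
    (hdiv₁ : ∀ t ∈ Ioo 0 T, ∀ k, ∑ j, ((k j : ℤ) : ℂ) * π j ((w₁ t : (d → ℤ) → V) k) = 0)
    (hdiv₂ : ∀ t ∈ Ioo 0 T, ∀ k, ∑ j, ((k j : ℤ) : ℂ) * π j ((w₂ t : (d → ℤ) → V) k) = 0)
    {A : ℝ} (hA : ∀ t ∈ Ioo 0 T,
      (∑' l, ENNReal.ofReal (sobolevWeight 1 l) * ‖wmul (-2) (⇑(w₁ t)) l‖ₑ).toReal ≤ A) :
    EqOn w₁ w₂ (Icc 0 T) := by
  -- the `L²` weight and the energy of the difference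
  obtain ⟨D, hD⟩ := exists_diagCLM (V := V) (abs_sobolevWeight_neg_two_sq_le (d := d))
  have hDsymm := diag_symm hD
  set η : ℝ → lp (fun _ : (d → ℤ) => V) 2 := fun t => w₁ t - w₂ t with hηdef
  set e : ℝ → ℝ := fun t => RCLike.re ⟪D (η t), η t⟫_ℂ with hedef
  have he_eq : ∀ t, e t = (eNormSq 0 (wmul (-2) (⇑(η t)))).toReal := fun t => re_inner_diag_four_self hD (η t)
  have he0 : ∀ t, 0 ≤ e t := fun t => by rw [he_eq]; exact ENNReal.toReal_nonneg
  have hηc : ContinuousOn η (Icc 0 T) := hw₁c.sub hw₂c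
  have hec : ContinuousOn e (Icc 0 T) := by
    have h1 : ContinuousOn (fun τ => ⟪D (η τ), η τ⟫_ℂ) (Icc 0 T) := (D.continuous.comp_continuousOn hηc).inner hηc
    exact RCLike.continuous_re.comp_continuousOn h1
  have he_zero : e 0 = 0 := by
    have : η 0 = 0 := by simp only [hηdef, h0, sub_self]
    simp only [hedef, this, map_zero, inner_zero_left, map_zero]
  -- the constant
  set K : ℝ := 2 * (((Fintype.card d : ℝ) * (2 * Real.pi)) *
    ((∑' l, ENNReal.ofReal (sobolevWeight 1 l) * ‖Uv l‖ₑ).toReal + A)) with hK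
  -- the differential inequality on `(0, T)`
  have he' : ∀ t ∈ Ioo 0 T, HasDerivAt e (2 * RCLike.re ⟪D (η t), nsField ν Uv π P (w₁ t) - nsField ν Uv π P (w₂ t)⟫_ℂ) t := by
    intro t ht
    have hη' : HasDerivAt η (nsField ν Uv π P (w₁ t) - nsField ν Uv π P (w₂ t)) t :=
      (hw₁' t ht).sub (hw₂' t ht)
    exact hasDerivWithinAt_univ.1 (hasDerivWithinAt_re_inner_diag hDsymm (S := univ) hη'.hasDerivWithinAt)
  have hbound : ∀ t ∈ Ioo 0 T,
      2 * RCLike.re ⟪D (η t), nsField ν Uv π P (w₁ t) - nsField ν Uv π P (w₂ t)⟫_ℂ ≤ K * e t := by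
    intro t ht
    -- unscaled families
    set u₁ := wmul (-2) (⇑(w₁ t)) with hu₁
    set u₂ := wmul (-2) (⇑(w₂ t)) with hu₂
    have hu₁r : RapidDecay u₁ := rapidDecay_wmul (hr₁ t ht) (-2)
    have hu₂r : RapidDecay u₂ := rapidDecay_wmul (hr₂ t ht) (-2)
    have hb₁ : w₁ t ∈ box (fun k => ‖(w₁ t : (d → ℤ) → V) k‖) π P :=
      mem_box.2 ⟨fun k => le_rfl, hfix₁ t ht, hreal₁ t ht, hdiv₁ t ht⟩
    have hb₂ : w₂ t ∈ box (fun k => ‖(w₂ t : (d → ℤ) → V) k‖) π P :=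
      mem_box.2 ⟨fun k => le_rfl, hfix₂ t ht, hreal₂ t ht, hdiv₂ t ht⟩
    have hfix₁' : ∀ k, P k (u₁ k) = u₁ k := fun k => by
      rw [hu₁, wmul_apply, map_smul, hfix₁ t ht k]
    have hfix₂' : ∀ k, P k (u₂ k) = u₂ k := fun k => by
      rw [hu₂, wmul_apply, map_smul, hfix₂ t ht k]
    have hreal₂' : ∀ j p, π j (u₂ (-p)) = conj (π j (u₂ p)) := fun j p => comp_unscale_real hb₂ j p
    have hdiv₂' : ∑ j, freqDeriv j (fun p => π j (u₂ p)) = 0 := comp_unscale_div hb₂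
    -- the fields take their defining values
    have hF : wmul (-2) (⇑(nsField ν Uv π P (w₁ t) - nsField ν Uv π P (w₂ t))) =
        (fun k => P k (linCoeff ν Uv π u₁ k + bilCoeff π u₁ u₁ k)) -
          fun k => P k (linCoeff ν Uv π u₂ k + bilCoeff π u₂ u₂ k) := by
      rw [lp.coeFn_sub, wmul_sub, nsField_eq, nsField_eq, lp.coeFn_add, lp.coeFn_add,
        coe_linOp_of_rapidDecay hUv hPn (hr₁ t ht), coe_bilOp_of_rapidDecay hPn (hr₁ t ht) (hr₁ t ht),
        coe_linOp_of_rapidDecay hUv hPn (hr₂ t ht), coe_bilOp_of_rapidDecay hPn (hr₂ t ht) (hr₂ t ht)]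
      funext k
      simp only [wmul_apply, Pi.sub_apply, Pi.add_apply, smul_add, map_add, smul_smul, ← Complex.ofReal_mul,
        sobolevWeight_neg_mul_sobolevWeight, Complex.ofReal_one, one_smul, hu₁, hu₂]
    -- the pairing
    have hpair : RCLike.re ⟪D (η t), nsField ν Uv π P (w₁ t) - nsField ν Uv π P (w₂ t)⟫_ℂ =
        (pairing ((fun k => P k (linCoeff ν Uv π u₁ k + bilCoeff π u₁ u₁ k)) -
          fun k => P k (linCoeff ν Uv π u₂ k + bilCoeff π u₂ u₂ k)) (u₁ - u₂)).re := by
      have hηu : wmul (-2) (⇑(η t)) = u₁ - u₂ := by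
        rw [hηdef]; simp only; rw [lp.coeFn_sub, wmul_sub]
      rw [inner_diag_four_eq_pairing hD, hF, hηu, RCLike.re_to_complex, pairing_comm, Complex.conj_re]
    have hest := two_re_pairing_field_sub_le hν hUv π hπ hUreal hUdiv P hPsa hu₁r hu₂r hfix₁' hfix₂' hreal₂' hdiv₂'
    have hAt := hA t ht
    rw [← hu₁] at hAt
    have hE0 : 0 ≤ (eNormSq 0 (u₁ - u₂)).toReal := ENNReal.toReal_nonneg
    have he_t : e t = (eNormSq 0 (u₁ - u₂)).toReal := by
      rw [he_eq]
      congr 2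
      rw [hηdef]; simp only; rw [lp.coeFn_sub, wmul_sub]
    rw [hpair, he_t, hK]
    refine hest.trans ?_
    have hc0 : 0 ≤ (Fintype.card d : ℝ) * (2 * Real.pi) := by positivity
    have hcE : 0 ≤ (Fintype.card d : ℝ) * (2 * Real.pi) * (eNormSq 0 (u₁ - u₂)).toReal := mul_nonneg hc0 hE0
    nlinarith [mul_le_mul_of_nonneg_left hAt hcE]
  -- Gronwall on `[s, t]`, then `s → 0⁺`
  intro t ht
  rcases eq_or_lt_of_le ht.1 with h | htpos
  · rw [← h]; exact h0
  have het : e t ≤ 0 := by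
    have hgron : ∀ s ∈ Ioo 0 t, e t ≤ e s * Real.exp (K * (t - s)) := by
      intro s hs
      -- shifted energy on `[0, t - s]`
      have hsT : ∀ τ ∈ Icc 0 (t - s), s + τ ∈ Icc 0 T := fun τ hτ =>
        ⟨by linarith [hs.1, hτ.1], by linarith [hτ.2, ht.2]⟩
      have hsT' : ∀ τ ∈ Ico 0 (t - s), s + τ ∈ Ioo 0 T := fun τ hτ =>
        ⟨by linarith [hs.1, hτ.1], by linarith [hτ.2, ht.2]⟩
      have hfc : ContinuousOn (fun τ => e (s + τ)) (Icc 0 (t - s)) :=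
        hec.comp (continuousOn_const.add continuousOn_id) fun τ hτ => hsT τ hτ
      have hf' : ∀ τ ∈ Ico 0 (t - s), HasDerivWithinAt (fun τ => e (s + τ))
          (2 * RCLike.re ⟪D (η (s + τ)), nsField ν Uv π P (w₁ (s + τ)) - nsField ν Uv π P (w₂ (s + τ))⟫_ℂ)
          (Ici τ) τ := by
        intro τ hτ
        have h := he' (s + τ) (hsT' τ hτ)
        have h2 : HasDerivAt (fun τ => e (s + τ))
            (2 * RCLike.re ⟪D (η (s + τ)), nsField ν Uv π P (w₁ (s + τ)) - nsField ν Uv π P (w₂ (s + τ))⟫_ℂ) τ := by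
          have := h.comp τ ((hasDerivAt_id τ).const_add s)
          simpa only [mul_one, Function.comp_def] using this
        exact h2.hasDerivWithinAt
      have hb : ∀ τ ∈ Ico 0 (t - s),
          2 * RCLike.re ⟪D (η (s + τ)), nsField ν Uv π P (w₁ (s + τ)) - nsField ν Uv π P (w₂ (s + τ))⟫_ℂ ≤
            K * e (s + τ) + 0 := fun τ hτ => by rw [add_zero]; exact hbound (s + τ) (hsT' τ hτ)
      have hG := le_gronwallBound_of_hasDerivWithinAt hfc hf' hb (t - s) ⟨by linarith [hs.2], le_rfl⟩
      simpa only [add_sub_cancel, add_zero, sub_zero, gronwallBound_ε0] using hG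
    -- `e s · e^{K(t−s)} → e 0 · e^{Kt} = 0` as `s → 0⁺`
    have hT0 : 0 < T := htpos.trans_le ht.2
    have hc : ContinuousWithinAt e (Icc 0 T) 0 := hec 0 ⟨le_rfl, hT0.le⟩
    have hc' : Tendsto e (𝓝[>] 0) (𝓝 (e 0)) :=
      (hc.mono_of_mem_nhdsWithin (mem_of_superset (Ioo_mem_nhdsGT hT0) Ioo_subset_Icc_self)).tendsto
    have hexp : Tendsto (fun s : ℝ => Real.exp (K * (t - s))) (𝓝[>] 0) (𝓝 (Real.exp (K * (t - 0)))) :=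
      ((Real.continuous_exp.comp (continuous_const.mul (continuous_const.sub continuous_id))).tendsto 0).mono_left
        nhdsWithin_le_nhds
    have hlim := hc'.mul hexp
    rw [he_zero, zero_mul] at hlim
    have hev : ∀ᶠ s in 𝓝[>] (0 : ℝ), e t ≤ e s * Real.exp (K * (t - s)) := by
      filter_upwards [Ioo_mem_nhdsGT htpos] with s hs using hgron s hs
    exact ge_of_tendsto hlim hev
  have het0 : e t = 0 := le_antisymm het (he0 t)
  -- `e t = 0 ⇒ η t = 0`
  have hsum := summable_symbol_mul_norm_sq (abs_sobolevWeight_neg_two_sq_le (d := d)) (η t)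
  have htsum : ∑' k, sobolevWeight (-2) k ^ 2 * ‖(η t : (d → ℤ) → V) k‖ ^ 2 = 0 := by
    rw [← re_inner_diag_self_eq_tsum hD (abs_sobolevWeight_neg_two_sq_le (d := d)) (η t)]
    exact het0
  have hzero : ∀ k, (η t : (d → ℤ) → V) k = 0 := by
    intro k
    have hle : sobolevWeight (-2) k ^ 2 * ‖(η t : (d → ℤ) → V) k‖ ^ 2 ≤ 0 := by
      rw [← htsum]
      exact hsum.le_tsum k fun j _ => mul_nonneg (sq_nonneg _) (sq_nonneg _)
    have hw : 0 < sobolevWeight (-2) k ^ 2 := pow_pos (sobolevWeight_pos _ _) 2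
    have : ‖(η t : (d → ℤ) → V) k‖ ^ 2 ≤ 0 := by nlinarith
    exact norm_eq_zero.1 (by nlinarith [norm_nonneg ((η t : (d → ℤ) → V) k)])
  have hηt : η t = 0 := lp.ext (funext hzero)
  have : w₁ t - w₂ t = 0 := hηt
  exact sub_eq_zero.1 this

end Unique

end Summit.NavierStokesRegularity.FluidComputer.TransportGalerkinUnique

end
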